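import Summits.Ventures.Crystal3D.Theorems.StickyWulffConstantCoaxialWallLawInPlaneCount
import Summits.Ventures.Crystal3D.Theorems.StickyWulffConstantCoaxialWallLawTwinWord
import HarnessLib

/-!
# The riser count under the crux's co-axiality hypothesis (bottom grain)

HONEST FRAMING. Part of the venture `Summits/Ventures/Crystal3D` (cell `crystal3d-full`), helper
`--supports` the crux `CoaxialWallLaw` (stmt-Ventures-19481, `route-Ventures-StickyWulffConstant`),
REGISTERED line `WallLedgerF` (planner cf-p1 gen 16), stub `stub_coaxialTwoSlabAdhesion`.
Capstone of this seat's chain: `inPlane_vacancies_ge_sine` (`…InPlaneCount`) composed with the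
frame normalisation `coaxial_frame_eq_fcc_of_one` / `coaxial_frame_eq_fcc_of_neg_one`
(`…HaggConst`, `…TwinWord`).

**Theorem (`coaxial_inPlane_vacancies`).**  Let the bottom grain `A₁·Λ₀ + t₁` be presented
co-axially, `A₁·Λ₀ + t₁ ⊆ L·B(σ) + s₁` (`σ` a Hägg sequence) — the literal hypothesis of the crux
for grain 1 — and let `A₂·Λ₀ + t₂` be the top grain, disjoint from the bottom one as a point set.
For every unit packing `X` containing the complete clamped slabs (bottom `[−2R₀, −R₀]`, top
`[h + R₀, h + 2R₀]`, disc radius `ρ ≥ R₀ ≥ 3`):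

  `√6 · √(1 − ⟪L e₃, e₃⟫²) · π ρ² − 3√2 π (6R₀+16)(1+h) ρ ≤ Σ_{w ∈ {±L u, ±L v, ±L(v−u)}} #{x ∈ X ∩ grain 1 : x + w ∉ X}`

— the wall forces at least `√6 sin θ · πρ² − C(1+h)ρ` vacant IN-PLANE slots (in-plane for the
SHARED axis `m = L e₃`, exactly the crux's `√(1 − ⟪L e₃, e₃⟫²)`) on the balls of grain 1, for
ANY filling (no rigidity assumption: slot sites are lattice sites, so off-lattice balls never
occupy them).  The top grain is symmetric (reflect `z ↦ h − z`; not in this file).  With the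
two-grain ledger and the absorption inequality (landed for ≤ 2 foreign partners) this is the route
to `stub_coaxialTwoSlabAdhesion`'s `½ sin θ · πρ²` in the rigid case.
Also `halfTurn_triangularVec` (the half-turn negates the in-plane generators).
WHAT THIS IS NOT: the top-grain mirror statement, the absorption inequality for three partners,
coincidence sites; the stub; rung F-C1 not moved.
-/

noncomputable section

namespace Summit.Ventures.Crystal3D.Theorems

open Summit.Ventures.Crystal3D Finset
open Literature.MathematicalPhysics.StatisticalMechanics (barlowStacking fccStacking IsHaggSeq
  triangularVec₁ triangularVec₂)
open scoped InnerProductSpace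

/-- The half-turn about `e₃` negates the in-plane generators `u = (1,0,0)`, `v = (½, √3/2, 0)`. -/
theorem halfTurn_triangularVec :
    (ℝ ∙ EuclideanSpace.single (2 : Fin 3) (1 : ℝ)).reflection (triangularVec₁ 1) = -triangularVec₁ 1 ∧
      (ℝ ∙ EuclideanSpace.single (2 : Fin 3) (1 : ℝ)).reflection (triangularVec₂ 1) = -triangularVec₂ 1 := by
  constructor
  · obtain ⟨h0, h1, h2⟩ := halfTurn_coord (triangularVec₁ (1 : ℝ))
    ext l
    fin_cases l
    · simp only [Fin.zero_eta, Fin.isValue] at h0 ⊢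
      rw [h0]; simp [triangularVec₁]
    · simp only [Fin.mk_one, Fin.isValue] at h1 ⊢
      rw [h1]; simp [triangularVec₁]
    · simp only [Fin.reduceFinMk, Fin.isValue] at h2 ⊢
      rw [h2]; simp [triangularVec₁]
  · obtain ⟨h0, h1, h2⟩ := halfTurn_coord (triangularVec₂ (1 : ℝ))
    ext l
    fin_cases l
    · simp only [Fin.zero_eta, Fin.isValue] at h0 ⊢
      rw [h0]; simp [triangularVec₂]
    · simp only [Fin.mk_one, Fin.isValue] at h1 ⊢
      rw [h1]; simp [triangularVec₂]
    · simp only [Fin.reduceFinMk, Fin.isValue] at h2 ⊢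
      rw [h2]; simp [triangularVec₂]

/-- **The riser count under the crux's hypothesis (bottom grain).**  See the module docstring. -/
theorem coaxial_inPlane_vacancies
    (A₁ : EuclideanSpace ℝ (Fin 3) ≃ₗᵢ[ℝ] EuclideanSpace ℝ (Fin 3)) (t₁ : EuclideanSpace ℝ (Fin 3))
    [DecidablePred fun p : EuclideanSpace ℝ (Fin 3) =>
      p ∈ (fun q => A₁ q + t₁) '' fccStacking 1 (Real.sqrt (2 / 3))]
    (A₂ : EuclideanSpace ℝ (Fin 3) ≃ₗᵢ[ℝ] EuclideanSpace ℝ (Fin 3)) (t₂ : EuclideanSpace ℝ (Fin 3))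
    (L : EuclideanSpace ℝ (Fin 3) ≃ₗᵢ[ℝ] EuclideanSpace ℝ (Fin 3)) (s₁ : EuclideanSpace ℝ (Fin 3))
    {σ : ℤ → ℤ} (hσ : IsHaggSeq σ)
    (hsub : (fun p => A₁ p + t₁) '' fccStacking 1 (Real.sqrt (2 / 3)) ⊆
      (fun p => L p + s₁) '' barlowStacking 1 (Real.sqrt (2 / 3)) σ)
    (X : Finset (EuclideanSpace ℝ (Fin 3)))
    (hX : ∀ p ∈ X, ∀ q ∈ X, p ≠ q → 1 ≤ dist p q)
    (R₀ h ρ : ℝ) (hR₀ : 3 ≤ R₀) (hh : 0 ≤ h) (hρ : R₀ ≤ ρ)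
    (hP₁ : ∀ p ∈ (fun q => A₁ q + t₁) '' fccStacking 1 (Real.sqrt (2 / 3)),
      -(2 * R₀) ≤ p 2 → p 2 ≤ -R₀ → p 0 ^ 2 + p 1 ^ 2 ≤ ρ ^ 2 → p ∈ X)
    (hP₂ : ∀ p ∈ (fun q => A₂ q + t₂) '' fccStacking 1 (Real.sqrt (2 / 3)),
      h + R₀ ≤ p 2 → p 2 ≤ h + 2 * R₀ → p 0 ^ 2 + p 1 ^ 2 ≤ ρ ^ 2 → p ∈ X)
    (hdisj : ∀ p ∈ (fun q => A₁ q + t₁) '' fccStacking 1 (Real.sqrt (2 / 3)),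
      p ∉ (fun q => A₂ q + t₂) '' fccStacking 1 (Real.sqrt (2 / 3))) :
    Real.sqrt 6 * Real.sqrt (1 - ⟪L (EuclideanSpace.single (2 : Fin 3) (1 : ℝ)),
        EuclideanSpace.single (2 : Fin 3) (1 : ℝ)⟫_ℝ ^ 2) * Real.pi * ρ ^ 2 -
        3 * (Real.sqrt 2 * Real.pi * (6 * R₀ + 16) * (1 + h) * ρ) ≤
      (((X.filter fun p => p ∈ (fun q => A₁ q + t₁) '' fccStacking 1 (Real.sqrt (2 / 3))).filter
          fun p => p + L (triangularVec₁ 1) ∉ X).card : ℝ) +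
      (((X.filter fun p => p ∈ (fun q => A₁ q + t₁) '' fccStacking 1 (Real.sqrt (2 / 3))).filter
          fun p => p - L (triangularVec₁ 1) ∉ X).card : ℝ) +
      (((X.filter fun p => p ∈ (fun q => A₁ q + t₁) '' fccStacking 1 (Real.sqrt (2 / 3))).filter
          fun p => p + L (triangularVec₂ 1) ∉ X).card : ℝ) +
      (((X.filter fun p => p ∈ (fun q => A₁ q + t₁) '' fccStacking 1 (Real.sqrt (2 / 3))).filter
          fun p => p - L (triangularVec₂ 1) ∉ X).card : ℝ) +
      (((X.filter fun p => p ∈ (fun q => A₁ q + t₁) '' fccStacking 1 (Real.sqrt (2 / 3))).filter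
          fun p => p + L (triangularVec₂ 1 - triangularVec₁ 1) ∉ X).card : ℝ) +
      (((X.filter fun p => p ∈ (fun q => A₁ q + t₁) '' fccStacking 1 (Real.sqrt (2 / 3))).filter
          fun p => p - L (triangularVec₂ 1 - triangularVec₁ 1) ∉ X).card : ℝ) := by
  classical
  rcases hσ 0 with h1 | hm1
  · -- fcc word: the grain is `L·Λ₀ + s₁`
    have hset : (fun q => A₁ q + t₁) '' fccStacking 1 (Real.sqrt (2 / 3)) =
        (fun q => L q + s₁) '' fccStacking 1 (Real.sqrt (2 / 3)) :=
      coaxial_frame_eq_fcc_of_one A₁ t₁ L s₁ hσ hsub h1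
    have hfilt : (X.filter fun p => p ∈ (fun q => A₁ q + t₁) '' fccStacking 1 (Real.sqrt (2 / 3))) =
        X.filter fun p => p ∈ (fun q => L q + s₁) '' fccStacking 1 (Real.sqrt (2 / 3)) :=
      Finset.filter_congr (fun x _ => by rw [hset])
    have key := inPlane_vacancies_ge_sine L s₁ A₂ t₂ X hX R₀ h ρ hR₀ hh hρ
      (fun p hp => hP₁ p (by rw [hset]; exact hp))
      hP₂ (fun p hp => hdisj p (by rw [hset]; exact hp))
    rw [← hfilt] at key
    exact key
  · -- twin word: the grain is `(R.trans L)·Λ₀ + s₁`, `R` the half-turn about `e₃`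
    obtain ⟨hset, haxis⟩ := coaxial_frame_eq_fcc_of_neg_one A₁ t₁ L s₁ hσ hsub hm1
    set A' := ((ℝ ∙ EuclideanSpace.single (2 : Fin 3) (1 : ℝ)).reflection.trans L) with hA'
    have hfilt : (X.filter fun p => p ∈ (fun q => A₁ q + t₁) '' fccStacking 1 (Real.sqrt (2 / 3))) =
        X.filter fun p => p ∈ (fun q => A' q + s₁) '' fccStacking 1 (Real.sqrt (2 / 3)) :=
      Finset.filter_congr (fun x _ => by rw [hset])
    have key := inPlane_vacancies_ge_sine A' s₁ A₂ t₂ X hX R₀ h ρ hR₀ hh hρ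
      (fun p hp => hP₁ p (by rw [hset]; exact hp))
      hP₂ (fun p hp => hdisj p (by rw [hset]; exact hp))
    rw [← hfilt, haxis] at key
    -- the slots of `A'` are the negatives of the slots of `L`
    obtain ⟨hu, hv⟩ := halfTurn_triangularVec
    have e1 : A' (triangularVec₁ 1) = -L (triangularVec₁ 1) := by
      rw [hA', LinearIsometryEquiv.trans_apply, hu, map_neg]
    have e2 : A' (triangularVec₂ 1) = -L (triangularVec₂ 1) := by
      rw [hA', LinearIsometryEquiv.trans_apply, hv, map_neg]
    have e3 : A' (triangularVec₂ 1 - triangularVec₁ 1) = -L (triangularVec₂ 1 - triangularVec₁ 1) := by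
      rw [map_sub, map_sub, e1, e2]; abel
    rw [e1, e2, e3] at key
    simp only [sub_neg_eq_add, ← sub_eq_add_neg] at key
    linarith

end Summit.Ventures.Crystal3D.Theorems

end
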